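/-
Copyright (c) 2026 the pub-hodgecm-mathlib formalisation cell (harness21).  Prover seat hodgecm-mathlib-LH4-p14 (g8), Track B «K2-LIT», #184♮ = hLiu418 =
`stmt-HodgeConjecture-24832`; socket #41, KIND 1, K1-b♮ — THE LEVI-ADAPTED FRAMES OF RECORD as ONE ∃-package (K1b DESK WORD #14, typ2 (g3) PLAN v41, 2026-09-05).
THEOREMS ONLY (no `def`, no `instance`, no notation, no named-fact hypothesis, no `sorry`, default heartbeats).
-/
import Summits.HodgeConjecture.HodgeConjecture.Theorems.K2LiuKindOneLineLeviFrameDictionary    -- ★ p864846 the `blk ↔ archAt` Levi dictionary (this seat)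
import Summits.HodgeConjecture.HodgeConjecture.Theorems.K2LiuKindWArchSizeFramesOfRecord      -- ★ `archSizeFrames_of_closedForm`, entry bookkeeping (brings ★ arch₄)
import HarnessLib

/-!
# Crux `HLiu418`, socket #41, KIND 1 (K1-b♮) — `K2LiuKindOneLineLeviFramesOfRecord`: the LEVI-ADAPTED archimedean frames, ONE ∃-package

Cell `hodgecm-mathlib`, hLiu418 = `stmt-HodgeConjecture-24832` (helper lane `--supports … --as helper`, count-neutral), route of record `HCCMUnconditional`;
squad K2 ∕ K2Liu, socket #41, KIND 1.  K1b DESK WORD #14 (K2 bus 2026-09-05T03:00:11Z) + typ2 (g3) PLAN v41 (02:56:40Z): the eight by-value frame names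
`TF TFinv hTF hTF' MF hMF hTFe hTFe'` (+ `er := finSumFinEquiv`) of ★ p864699 `K2LiuKindOneLineDecayOneFrameRate.hdecF₀_of_blockLetter_rate` ∕ ★ p864745 `…_inl_rate`
are keyed to THIS package, in that binder ORDER, at `Sinf := {w // w.IsComplex}`, `wp := fun σ => σ`.

**`exists_leviFrames_of_record`** — from `dV dW ≠ 0` and the Levi chart letter `hΛ₀` of record: `∃ (T Tinv) (M : ℝ)`,
(1) `T σ · Tinv σ = 1`; (2) `Tinv σ · T σ = 1`; (3) `1 ≤ M`; (4)(5) `‖T σ i j‖, ‖Tinv σ i j‖ ≤ M` — the five conjuncts the TIE consumes — then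
(6) **THE LEVI IDENTITY** `T σ · (Λ₀ γ)_σ · Tinv σ = diag(σ(γ), G′)` for every `γ ∈ GL₂(L)` (★ `frame_archAt_levi_adapted`: at these frames ★ p864699's literal `σ(ĝ)`
IS the Levi block — what the `hBL₁′` PAYER consumes); (7) the tube clause `g ∈ U(J^𝔻)(L_σ) ⟹ (T σ · g · Tinv σ)ᴴ J (T σ · g · Tinv σ) = J` (★ arch₄ (i) ∘ ★ `leviScale_conj_mem_UJ`);
(8) the unipotent clause `u ∈ N_Δ ⟹ T σ · u · Tinv σ = (1 b; 0 1)`, `b` hermitian (★ arch₄ (iii), `b ↦ D⁻¹ b D⁻¹`); (9)(10) the CLOSED FORMS `T σ = m(D_σ⁻¹) · T₄ σ`,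
`Tinv σ = T₄inv σ · m(D_σ)` over ★ arch₄ (x)'s bytes (`D_σ = diag(√(|t_σk|∕2))`, `m(D⁻¹) = diag(D⁻¹, D)`), so every further ★ arch₄ clause transfers by
★ `tubeFrameAdapted_conj`.  The bound: `M := 4 · C₀ · M₄`, `C₀ = 1 + Σ_{σ,k} (2√(|t|∕2) + √(|t|∕2)⁻¹)`, `M₄` = ★ `archSizeFrames_of_closedForm`'s frame bound.
[HarrisKudlaSweet1996, §1 (1.11)] [Shimura1997, §18.1 (18.4), §A3] [BorelJacquet1979, §4.1].
HONEST LABEL.  Count-neutral helper; closes no socket by itself: `HC_CM` is proved only modulo the 7 printed citations (2 remaining named inputs: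
hLiu418 = `stmt-HodgeConjecture-24832`, h413 = `stmt-HodgeConjecture-24833`) until rung 0 closes.

## References
* [HarrisKudlaSweet1996] M. Harris, S. S. Kudla, W. J. Sweet, J. Amer. Math. Soc. 9 (1996), §1 (1.11) (the Siegel Levi `m(a)`).
* [Shimura1997] G. Shimura, CBMS 93 (1997), §18.1 (18.4), §A3.  [BorelJacquet1979] A. Borel, H. Jacquet, PSPM 33.1 (1979), §4.1.
-/

set_option autoImplicit false
set_option linter.dupNamespace false -- the mandated namespace repeats `HodgeConjecture.HodgeConjecture`

noncomputable section

open scoped Matrix ComplexConjugate Classical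
open Complex Matrix NumberField NumberField.InfinitePlace IsDedekindDomain
open Literature.NumberTheory.GelbartRogawski1991.AdaptedBlocks Literature.NumberTheory.Automorphic Literature.NumberTheory.Automorphic.UnitaryGroup
open Literature.NumberTheory.GelbartRogawski1991 Literature.NumberTheory.GelbartRogawski1991.GRConstruction
open UnitaryDualPair

namespace Summit.HodgeConjecture.HodgeConjecture.Cruxes.HLiu418.K2LiuKindOneLineLeviFramesOfRecord

open K2LiuSiegelUnipotentLocalDefs (IsUnipM)
open K2LiuHermitianTubeFrameSign (exists_tubeFrame_arch₄)
open K2LiuHermitianTubeFrameArch (tw_ne_zero)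
open K2LiuKindWArchSizeFramesOfRecord (norm_diagonal_apply_le norm_ofReal_le_of_abs_le archSizeFrames_of_closedForm)
open K2LiuKindOneLineLeviFrameDictionary (diagSqrtInv_mul_diagSqrt diagSqrt_mul_diagSqrtInv tubeFrameAdapted_mul_inv tubeFrameAdapted_inv_mul
  tubeFrameAdapted_conj leviScale_conj_mem_UJ frame_archAt_levi_adapted)

/-! ## §1 Entry bookkeeping -/

/-- `‖(A · B) i j‖ ≤ |ι| · a · b` from entrywise bounds `‖A‖ ≤ a`, `‖B‖ ≤ b` (`a ≥ 0`). [folklore] -/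
theorem norm_mul_apply_le {ι : Type} [Fintype ι] {A B : Matrix ι ι ℂ} {a b : ℝ} (ha : 0 ≤ a)
    (hA : ∀ i j, ‖A i j‖ ≤ a) (hB : ∀ i j, ‖B i j‖ ≤ b) (i j : ι) : ‖(A * B) i j‖ ≤ Fintype.card ι * (a * b) := by
  rw [Matrix.mul_apply]
  calc ‖∑ k, A i k * B k j‖ ≤ ∑ k, ‖A i k * B k j‖ := norm_sum_le _ _
    _ ≤ ∑ _k : ι, a * b := Finset.sum_le_sum fun k _ => by rw [norm_mul]; exact mul_le_mul (hA i k) (hB k j) (norm_nonneg _) ha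
    _ = Fintype.card ι * (a * b) := by rw [Finset.sum_const, Finset.card_univ, nsmul_eq_mul]

/-- every entry of `diag(diag p, diag s)` is bounded by a common nonnegative bound of `p, s`. [folklore] -/
theorem norm_blockDiag_diagonal_apply_le {p s : Fin 2 → ℂ} {C : ℝ} (hC : 0 ≤ C) (hp : ∀ k, ‖p k‖ ≤ C) (hs : ∀ k, ‖s k‖ ≤ C)
    (i j : Fin 2 ⊕ Fin 2) : ‖(fromBlocks (diagonal p) 0 0 (diagonal s) : Matrix (Fin 2 ⊕ Fin 2) (Fin 2 ⊕ Fin 2) ℂ) i j‖ ≤ C := by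
  rcases i with i | i <;> rcases j with j | j
  · rw [fromBlocks_apply₁₁]; exact norm_diagonal_apply_le hC hp i j
  · rw [fromBlocks_apply₁₂, Matrix.zero_apply, norm_zero]; exact hC
  · rw [fromBlocks_apply₂₁, Matrix.zero_apply, norm_zero]; exact hC
  · rw [fromBlocks_apply₂₂]; exact norm_diagonal_apply_le hC hs i j

/-- `m(D⁻¹) · (1 b; 0 1) · m(D) = (1 D⁻¹bD⁻¹; 0 1)` for the diagonal letter `D = diag(√(|t_k|∕2))`, `t_k ≠ 0`. [cite: HarrisKudlaSweet1996, §1 (1.11)] -/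
theorem leviScale_conj_unip {ι : Type} [Fintype ι] [DecidableEq ι] (t : ι → ℝ) (ht : ∀ k, t k ≠ 0) (b : Matrix ι ι ℂ) :
    Matrix.fromBlocks (diagonal (fun k => (((Real.sqrt (|t k| / 2))⁻¹ : ℝ) : ℂ))) 0 0 (diagonal (fun k => (Real.sqrt (|t k| / 2) : ℂ))) *
        Matrix.fromBlocks 1 b 0 1 *
        Matrix.fromBlocks (diagonal (fun k => (Real.sqrt (|t k| / 2) : ℂ))) 0 0 (diagonal (fun k => (((Real.sqrt (|t k| / 2))⁻¹ : ℝ) : ℂ))) =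
      Matrix.fromBlocks 1 (diagonal (fun k => (((Real.sqrt (|t k| / 2))⁻¹ : ℝ) : ℂ)) * b * diagonal (fun k => (((Real.sqrt (|t k| / 2))⁻¹ : ℝ) : ℂ))) 0 1 := by
  rw [Matrix.fromBlocks_multiply, Matrix.fromBlocks_multiply]
  simp only [Matrix.mul_one, Matrix.mul_zero, Matrix.zero_mul, add_zero, zero_add, diagSqrtInv_mul_diagSqrt t ht, diagSqrt_mul_diagSqrtInv t ht]

/-- `D⁻¹ b D⁻¹` is hermitian when `b` is (`D⁻¹` real diagonal). [cite: Shimura1997, §18.1 (18.4), §A3] -/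
theorem conjTranspose_diagSqrtInv_mul_mul {ι : Type} [Fintype ι] [DecidableEq ι] (t : ι → ℝ) {b : Matrix ι ι ℂ} (hb : bᴴ = b) :
    (diagonal (fun k => (((Real.sqrt (|t k| / 2))⁻¹ : ℝ) : ℂ)) * b * diagonal (fun k => (((Real.sqrt (|t k| / 2))⁻¹ : ℝ) : ℂ)))ᴴ =
      diagonal (fun k => (((Real.sqrt (|t k| / 2))⁻¹ : ℝ) : ℂ)) * b * diagonal (fun k => (((Real.sqrt (|t k| / 2))⁻¹ : ℝ) : ℂ)) := by
  have hD : (diagonal (fun k => (((Real.sqrt (|t k| / 2))⁻¹ : ℝ) : ℂ)))ᴴ = diagonal (fun k => (((Real.sqrt (|t k| / 2))⁻¹ : ℝ) : ℂ)) := by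
    rw [Matrix.diagonal_conjTranspose]; congr 1; ext k; exact Complex.conj_ofReal _
  rw [Matrix.conjTranspose_mul, Matrix.conjTranspose_mul, hD, hb, Matrix.mul_assoc]

/-! ## §2 The package -/

variable (L : Type) [Field L] [NumberField L] [IsCMField L]
variable {N₀ M₀ : ℕ} (e : Fin N₀ × Fin M₀ ≃ Fin 2)
  (dV : Fin N₀ → L) (hdV : ∀ i, IsCMField.complexConj L (dV i) = dV i)
  (dW : Fin M₀ → L) (hdW : ∀ i, IsCMField.complexConj L (dW i) = dW i)

/-- **THE LEVI-ADAPTED FRAMES OF RECORD, ONE ∃-PACKAGE** in ★ p864699's binder order (`T Tinv hT hT' M hM hTe hTe'`), then the LEVI IDENTITY (★ p864846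
`frame_archAt_levi_adapted`), the tube clause, the unipotent clause, and the closed forms `T σ = m(D_σ⁻¹) · T₄ σ`, `Tinv σ = T₄inv σ · m(D_σ)` over ★ arch₄ (x).
[cite: HarrisKudlaSweet1996, §1 (1.11)] [cite: Shimura1997, §18.1 (18.4), §A3] [cite: BorelJacquet1979, §4.1] -/
theorem exists_leviFrames_of_record (hdV0 : ∀ i, dV i ≠ 0) (hdW0 : ∀ i, dW i ≠ 0)
    (Λ₀ : GL (Fin 2) (AdeleRing (𝓞 L) L) →* HA L e dV hdV dW hdW)
    (hΛ₀ : ∀ g : GL (Fin 2) (AdeleRing (𝓞 L) L), blk L e dV hdV dW hdW (Λ₀ g) =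
      cayR (AdeleRing (𝓞 L) L) (Fin 2) * Matrix.fromBlocks (g : Matrix (Fin 2) (Fin 2) (AdeleRing (𝓞 L) L)) 0 0
        (((gramR L e dV hdV dW hdW).map ((algebraMap L (AdeleRing (𝓞 L) L)).comp (algebraMap (Fp L) L)))⁻¹ *
          (((g⁻¹ : GL (Fin 2) (AdeleRing (𝓞 L) L)) : Matrix (Fin 2) (Fin 2) (AdeleRing (𝓞 L) L)).map
            (conjAdele (Fp L) L (IsCMField.complexConj L)))ᵀ *
          (gramR L e dV hdV dW hdW).map ((algebraMap L (AdeleRing (𝓞 L) L)).comp (algebraMap (Fp L) L))) *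
        cayRinv (AdeleRing (𝓞 L) L) (Fin 2)) :
    ∃ (T Tinv : {w : InfinitePlace L // w.IsComplex} → Matrix (Fin 2 ⊕ Fin 2) (Fin 2 ⊕ Fin 2) ℂ) (M : ℝ),
      (∀ σ, T σ * Tinv σ = 1) ∧ (∀ σ, Tinv σ * T σ = 1) ∧ 1 ≤ M ∧
      (∀ σ (i j : Fin 2 ⊕ Fin 2), ‖T σ i j‖ ≤ M) ∧ (∀ σ (i j : Fin 2 ⊕ Fin 2), ‖Tinv σ i j‖ ≤ M) ∧
      -- (6) THE LEVI IDENTITY at every complex place and every rational Levi element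
      (∀ σ (γ : GL (Fin 2) L), ∃ G' : Matrix (Fin 2) (Fin 2) ℂ,
        T σ * Matrix.reindex (e₂ (n := 2)).symm (e₂ (n := 2)).symm
            (((UnitaryGroup.archAt (Fp L) L (IsCMField.complexConj L) (2 + 2) (hermD L e dV hdV dW hdW) σ
                (UnitaryGroup.complexConj_smul_infinitePlace L σ.1) (IsCMField.complexConj_ne_one L)
                (UnitaryGroup.archPart (Fp L) L (IsCMField.complexConj L) (2 + 2) (hermD L e dV hdV dW hdW)
                  (Λ₀ (Matrix.GeneralLinearGroup.map (algebraMap L (AdeleRing (𝓞 L) L)) γ))) :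
                UnitaryGroup.archLocal L (2 + 2) (hermD L e dV hdV dW hdW) σ) : GL (Fin (2 + 2)) ℂ) : Matrix (Fin (2 + 2)) (Fin (2 + 2)) ℂ) * Tinv σ =
          Matrix.fromBlocks ((γ : Matrix (Fin 2) (Fin 2) L).map σ.1.embedding) 0 0 G') ∧
      -- (7) the tube clause
      (∀ σ (g : GL (Fin (2 + 2)) ℂ), g ∈ UnitaryGroup.archLocal L (2 + 2) (hermD L e dV hdV dW hdW) σ →
        (T σ * Matrix.reindex (e₂ (n := 2)).symm (e₂ (n := 2)).symm (g : Matrix _ _ ℂ) * Tinv σ)ᴴ * Matrix.J (Fin 2) ℂ *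
          (T σ * Matrix.reindex (e₂ (n := 2)).symm (e₂ (n := 2)).symm (g : Matrix _ _ ℂ) * Tinv σ) = Matrix.J (Fin 2) ℂ) ∧
      -- (8) the unipotent clause
      (∀ σ (u : GL (Fin (2 + 2)) ℂ), u ∈ UnitaryGroup.archLocal L (2 + 2) (hermD L e dV hdV dW hdW) σ → IsUnipM (n := 2) (u : Matrix (Fin (2 + 2)) (Fin (2 + 2)) ℂ) →
        ∃ b : Matrix (Fin 2) (Fin 2) ℂ, bᴴ = b ∧ T σ * Matrix.reindex (e₂ (n := 2)).symm (e₂ (n := 2)).symm (u : Matrix _ _ ℂ) * Tinv σ = fromBlocks 1 b 0 1) ∧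
      -- (9)(10) the closed forms over ★ arch₄ (x)
      (∀ σ, T σ = Matrix.fromBlocks (diagonal (fun k => (((Real.sqrt (|(σ.1.embedding (dV (e.symm k).1 * dW (e.symm k).2)).re| / 2))⁻¹ : ℝ) : ℂ))) 0 0
          (diagonal (fun k => (Real.sqrt (|(σ.1.embedding (dV (e.symm k).1 * dW (e.symm k).2)).re| / 2) : ℂ))) *
        fromBlocks (diagonal (fun k => (Real.sqrt (|(σ.1.embedding (dV (e.symm k).1 * dW (e.symm k).2)).re| / 2) : ℂ)))
          (diagonal (fun k => (Real.sqrt (|(σ.1.embedding (dV (e.symm k).1 * dW (e.symm k).2)).re| / 2) : ℂ)))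
          (diagonal (fun k => I * ((((σ.1.embedding (dV (e.symm k).1 * dW (e.symm k).2)).re / |(σ.1.embedding (dV (e.symm k).1 * dW (e.symm k).2)).re|) *
            Real.sqrt (|(σ.1.embedding (dV (e.symm k).1 * dW (e.symm k).2)).re| / 2) : ℝ) : ℂ)))
          (-diagonal (fun k => I * ((((σ.1.embedding (dV (e.symm k).1 * dW (e.symm k).2)).re / |(σ.1.embedding (dV (e.symm k).1 * dW (e.symm k).2)).re|) *
            Real.sqrt (|(σ.1.embedding (dV (e.symm k).1 * dW (e.symm k).2)).re| / 2) : ℝ) : ℂ)))) ∧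
      (∀ σ, Tinv σ = fromBlocks (diagonal (fun k => (((Real.sqrt (|(σ.1.embedding (dV (e.symm k).1 * dW (e.symm k).2)).re| / 2))⁻¹ / 2 : ℝ) : ℂ)))
          (-diagonal (fun k => I * (((Real.sqrt (|(σ.1.embedding (dV (e.symm k).1 * dW (e.symm k).2)).re| / 2))⁻¹ *
            ((σ.1.embedding (dV (e.symm k).1 * dW (e.symm k).2)).re / |(σ.1.embedding (dV (e.symm k).1 * dW (e.symm k).2)).re|) / 2 : ℝ) : ℂ)))
          (diagonal (fun k => (((Real.sqrt (|(σ.1.embedding (dV (e.symm k).1 * dW (e.symm k).2)).re| / 2))⁻¹ / 2 : ℝ) : ℂ)))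
          (diagonal (fun k => I * (((Real.sqrt (|(σ.1.embedding (dV (e.symm k).1 * dW (e.symm k).2)).re| / 2))⁻¹ *
            ((σ.1.embedding (dV (e.symm k).1 * dW (e.symm k).2)).re / |(σ.1.embedding (dV (e.symm k).1 * dW (e.symm k).2)).re|) / 2 : ℝ) : ℂ))) *
        Matrix.fromBlocks (diagonal (fun k => (Real.sqrt (|(σ.1.embedding (dV (e.symm k).1 * dW (e.symm k).2)).re| / 2) : ℂ))) 0 0
          (diagonal (fun k => (((Real.sqrt (|(σ.1.embedding (dV (e.symm k).1 * dW (e.symm k).2)).re| / 2))⁻¹ : ℝ) : ℂ)))) := by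
  -- the frames of record (★ arch₄, closed forms) and their size letters
  choose T₄ T₄inv h1 h2 hTU _hTS hTiv _hTN _hTV _hW hTdef hTinvdef using fun w : {w : InfinitePlace L // w.IsComplex} =>
    exists_tubeFrame_arch₄ L e dV hdV dW hdW w (UnitaryGroup.complexConj_smul_infinitePlace L w.1) hdV0 hdW0
  obtain ⟨_, _, _, _, _, M₄, -, -, -, -, -, -, -, -, -, -, -, -, hM₄, hTe, hTe'⟩ :=
    archSizeFrames_of_closedForm L e dV hdV dW hdW hdV0 hdW0 T₄ T₄inv hTdef hTinvdef
  -- the letters `t_{σk} ≠ 0`, `δ_{σk} = √(|t|∕2) > 0`, the crude common bound `C₀`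
  have ht0 : ∀ (σ : {w : InfinitePlace L // w.IsComplex}) (k : Fin 2), (σ.1.embedding (dV (e.symm k).1 * dW (e.symm k).2)).re ≠ 0 := fun σ k =>
    tw_ne_zero L e dV hdV dW hdW σ (UnitaryGroup.complexConj_smul_infinitePlace L σ.1) hdV0 hdW0 k
  obtain ⟨δ, hδ⟩ : ∃ δ : {w : InfinitePlace L // w.IsComplex} → Fin 2 → ℝ,
      ∀ σ k, δ σ k = Real.sqrt (|(σ.1.embedding (dV (e.symm k).1 * dW (e.symm k).2)).re| / 2) := ⟨_, fun _ _ => rfl⟩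
  have hδ0 : ∀ σ k, 0 < δ σ k := fun σ k => by rw [hδ]; exact Real.sqrt_pos.2 (div_pos (abs_pos.2 (ht0 σ k)) two_pos)
  obtain ⟨C₀, hC₀⟩ : ∃ C₀ : ℝ, C₀ = 1 + ∑ σ, ∑ k, (2 * δ σ k + (δ σ k)⁻¹) := ⟨_, rfl⟩
  have hterm : ∀ σ k, 0 ≤ 2 * δ σ k + (δ σ k)⁻¹ := fun σ k => by have := hδ0 σ k; positivity
  have hle : ∀ σ k, 2 * δ σ k + (δ σ k)⁻¹ ≤ C₀ := fun σ k => by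
    have h1' : 2 * δ σ k + (δ σ k)⁻¹ ≤ ∑ k', (2 * δ σ k' + (δ σ k')⁻¹) :=
      Finset.single_le_sum (f := fun k' => 2 * δ σ k' + (δ σ k')⁻¹) (fun k' _ => hterm σ k') (Finset.mem_univ k)
    have h2' : ∑ k', (2 * δ σ k' + (δ σ k')⁻¹) ≤ ∑ σ', ∑ k', (2 * δ σ' k' + (δ σ' k')⁻¹) :=
      Finset.single_le_sum (f := fun σ' => ∑ k', (2 * δ σ' k' + (δ σ' k')⁻¹)) (fun σ' _ => Finset.sum_nonneg fun k' _ => hterm σ' k') (Finset.mem_univ σ)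
    rw [hC₀]; linarith
  have hC₀1 : 1 ≤ C₀ := by
    rw [hC₀]; have := Finset.sum_nonneg fun σ (_ : σ ∈ Finset.univ) => Finset.sum_nonneg fun k (_ : k ∈ Finset.univ) => hterm σ k; linarith
  have hC₀0 : 0 ≤ C₀ := zero_le_one.trans hC₀1
  have hδle : ∀ σ k, ‖((δ σ k : ℝ) : ℂ)‖ ≤ C₀ := fun σ k => norm_ofReal_le_of_abs_le <| by
    rw [abs_of_pos (hδ0 σ k)]; have := inv_pos.2 (hδ0 σ k); linarith [hle σ k]
  have hδle' : ∀ σ k, ‖(((δ σ k)⁻¹ : ℝ) : ℂ)‖ ≤ C₀ := fun σ k => norm_ofReal_le_of_abs_le <| by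
    rw [abs_of_pos (inv_pos.2 (hδ0 σ k))]; have := hδ0 σ k; linarith [hle σ k]
  -- entry bounds of `m(D⁻¹)` and `m(D)`
  have hmle : ∀ σ (i j : Fin 2 ⊕ Fin 2), ‖(fromBlocks (diagonal (fun k => (((δ σ k)⁻¹ : ℝ) : ℂ))) 0 0 (diagonal (fun k => ((δ σ k : ℝ) : ℂ))) :
      Matrix (Fin 2 ⊕ Fin 2) (Fin 2 ⊕ Fin 2) ℂ) i j‖ ≤ C₀ := fun σ => norm_blockDiag_diagonal_apply_le hC₀0 (hδle' σ) (hδle σ)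
  have hmle' : ∀ σ (i j : Fin 2 ⊕ Fin 2), ‖(fromBlocks (diagonal (fun k => ((δ σ k : ℝ) : ℂ))) 0 0 (diagonal (fun k => (((δ σ k)⁻¹ : ℝ) : ℂ))) :
      Matrix (Fin 2 ⊕ Fin 2) (Fin 2 ⊕ Fin 2) ℂ) i j‖ ≤ C₀ := fun σ => norm_blockDiag_diagonal_apply_le hC₀0 (hδle σ) (hδle' σ)
  have hM₄0 : 0 ≤ M₄ := zero_le_one.trans hM₄
  -- the reassociation `T′ X T′⁻¹ = m(D⁻¹) (T₄ X T₄⁻¹) m(D)` in the `δ` letters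
  have assoc : ∀ σ (X : Matrix (Fin 2 ⊕ Fin 2) (Fin 2 ⊕ Fin 2) ℂ),
      (fromBlocks (diagonal (fun k => (((δ σ k)⁻¹ : ℝ) : ℂ))) 0 0 (diagonal (fun k => ((δ σ k : ℝ) : ℂ))) * T₄ σ) * X *
          (T₄inv σ * fromBlocks (diagonal (fun k => ((δ σ k : ℝ) : ℂ))) 0 0 (diagonal (fun k => (((δ σ k)⁻¹ : ℝ) : ℂ)))) =
        fromBlocks (diagonal (fun k => (((δ σ k)⁻¹ : ℝ) : ℂ))) 0 0 (diagonal (fun k => ((δ σ k : ℝ) : ℂ))) * (T₄ σ * X * T₄inv σ) *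
          fromBlocks (diagonal (fun k => ((δ σ k : ℝ) : ℂ))) 0 0 (diagonal (fun k => (((δ σ k)⁻¹ : ℝ) : ℂ))) := fun σ X => by
    simp only [Matrix.mul_assoc]
  simp only [← hδ]
  refine ⟨fun σ => fromBlocks (diagonal (fun k => (((δ σ k)⁻¹ : ℝ) : ℂ))) 0 0 (diagonal (fun k => ((δ σ k : ℝ) : ℂ))) * T₄ σ,
    fun σ => T₄inv σ * fromBlocks (diagonal (fun k => ((δ σ k : ℝ) : ℂ))) 0 0 (diagonal (fun k => (((δ σ k)⁻¹ : ℝ) : ℂ))),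
    (Fintype.card (Fin 2 ⊕ Fin 2) : ℝ) * (C₀ * M₄), ?_, ?_, ?_, ?_, ?_, ?_, ?_, ?_, ?_, ?_⟩
  · -- (1) `T Tinv = 1`
    intro σ
    have key := tubeFrameAdapted_mul_inv (fun k => (σ.1.embedding (dV (e.symm k).1 * dW (e.symm k).2)).re) (ht0 σ) (h1 σ)
    simp only [← hδ] at key
    exact key
  · -- (2) `Tinv T = 1`
    intro σ
    have key := tubeFrameAdapted_inv_mul (fun k => (σ.1.embedding (dV (e.symm k).1 * dW (e.symm k).2)).re) (ht0 σ) (h2 σ)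
    simp only [← hδ] at key
    exact key
  · -- (3) `1 ≤ M`
    have hcard : (1 : ℝ) ≤ (Fintype.card (Fin 2 ⊕ Fin 2) : ℝ) := by norm_num [Fintype.card_sum, Fintype.card_fin]
    exact one_le_mul_of_one_le_of_one_le hcard (one_le_mul_of_one_le_of_one_le hC₀1 hM₄)
  · -- (4) entries of `T`
    intro σ i j
    exact norm_mul_apply_le hC₀0 (hmle σ) (hTe σ) i j
  · -- (5) entries of `Tinv`
    intro σ i j
    rw [mul_comm C₀ M₄]
    exact norm_mul_apply_le hM₄0 (hTe' σ) (hmle' σ) i j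
  · -- (6) the Levi identity
    intro σ γ
    have key := frame_archAt_levi_adapted L e dV hdV dW hdW hdV0 hdW0 Λ₀ hΛ₀ σ (UnitaryGroup.complexConj_smul_infinitePlace L σ.1)
      (IsCMField.complexConj_ne_one L) (hTdef σ) (hTinvdef σ) γ
    simp only [← hδ] at key
    exact ⟨_, key⟩
  · -- (7) the tube clause
    intro σ g hg
    have key := leviScale_conj_mem_UJ (fun k => (σ.1.embedding (dV (e.symm k).1 * dW (e.symm k).2)).re) (ht0 σ) (hTU σ g hg)
    simp only [← hδ] at key
    dsimp only
    rw [assoc]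
    exact key
  · -- (8) the unipotent clause
    intro σ u hu hU
    obtain ⟨b, hb, hub⟩ := hTiv σ u hu hU
    refine ⟨diagonal (fun k => (((δ σ k)⁻¹ : ℝ) : ℂ)) * b * diagonal (fun k => (((δ σ k)⁻¹ : ℝ) : ℂ)), ?_, ?_⟩
    · have key := conjTranspose_diagSqrtInv_mul_mul (fun k => (σ.1.embedding (dV (e.symm k).1 * dW (e.symm k).2)).re) hb
      simp only [← hδ] at key
      exact key
    · have key := leviScale_conj_unip (fun k => (σ.1.embedding (dV (e.symm k).1 * dW (e.symm k).2)).re) (ht0 σ) b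
      simp only [← hδ] at key
      dsimp only
      rw [assoc, hub]
      exact key
  · -- (9) closed form of `T`
    intro σ
    dsimp only
    rw [hTdef σ]
    simp only [← hδ]
  · -- (10) closed form of `Tinv`
    intro σ
    dsimp only
    rw [hTinvdef σ]
    simp only [← hδ]

end Summit.HodgeConjecture.HodgeConjecture.Cruxes.HLiu418.K2LiuKindOneLineLeviFramesOfRecord

end
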